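import Summits.CriticalPhenomena.PercolationContinuityZ3.Theorems.PercNearOneGluingNoHeavyRsw3WMSFTrunk
import Summits.CriticalPhenomena.PercolationContinuityZ3.Theorems.PercNearOneGluingNoHeavyRsw3InvasionLocality
import Literature.Barriers.CriticalPhenomena.SubexponentialGrowthZdFiniteTrees
import HarnessLib

/-!
# RSW3 lane (P2, gen 30): THE WIRED MINIMAL SPANNING FOREST, III — MEASURABILITY AND EQUIVARIANCE of the invasion trees, of `𝔉_w`, of the
# infinite-branch events and of forest connections (the inputs of the mass-transport principle)

builds on p205010 (kernel theorem, internal audit signed; external expert review pending) — NOT used in this file.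

Cell `prim-rsw3`, prover seat `prim-rsw3-p2` (gen 30), memo `run/shared/lean/prim/rsw3/P2-RSWLITE.md` §37.  Support file
(`--supports stmt-CriticalPhenomena-4575`); no definitions, no named facts, no sorries.  Third file of the programme "every component of `𝔉_w(ℤ^d)` has
EXACTLY ONE end" (Lyons–Peres 2016 Thm. 11.12): the two mass transports of files IV–V are indicator functions of events built from
`T_U(x) = treeEdges G U x`, `𝔉_w(U) = wmsf G U`, the infinite-branch relation `InfBranch` of the Barriers library (Lyons–Peres Prop. 8.18's `ξ(x, y; 𝔉)`)
and forest connections; the mass-transport principle (`Literature.Barriers.CriticalPhenomena.lintegral_tsum_eq_of_isGraphUnimodular`) needs them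
MEASURABLE in the label field and INVARIANT under the diagonal action of the automorphisms `γ` of the graph on vertices and labels
(`actLabels γ U = U ∘ Sym2.map γ⁻¹`).

* §1 measurability (countable vertex set): `measurable_acceptedLabel`, `measurableSet_isOutlet`, `measurable_treeEdges`, `measurable_wmsf`,
  `measurableSet_injective`, `measurableSet_infBranch_treeEdges`, `measurableSet_infBranch_wmsf`, `measurableSet_wmsf_reachable`,
  `measurableSet_wmsf_openClusterIn`.
* §2 equivariance under a graph isomorphism `φ : G ≃g G'` with transported labels `U' s(φ u, φ v) = U s(u, v)`: `treeEdges_iso` (labels injective on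
  bonds; gen 29 file XXXVII), `wmsf_iso` (every label field), and for an automorphism `γ` with `actLabels γ`: `actLabels_mk`, `injective_actLabels_iff`,
  `treeEdges_actLabels`, `wmsf_actLabels`, `infBranch_treeEdges_actLabels_iff`, `infBranch_wmsf_actLabels_iff`, `wmsf_reachable_actLabels_iff`,
  `mem_openClusterIn_wmsf_actLabels_iff`.

References: R. Lyons, Y. Peres, *Probability on Trees and Networks* (2016), §8.1–8.2 (mass transport: measurability and diagonal invariance), Prop. 8.18,
Thm. 11.12 [LyonsPeres2016]; R. Lyons, Y. Peres, O. Schramm, Ann. Probab. 34 (2006) §3 [LyonsPeresSchramm2006].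
-/

noncomputable section

namespace Summit.CriticalPhenomena.PercolationContinuityZ3.Theorems.Rsw3

open Finset Filter MeasureTheory Literature.Probability.LatticeModels Literature.Probability.Percolation
open Literature.Probability.Percolation.Invasion Literature.Barriers.CriticalPhenomena

section General

variable {V : Type*} [DecidableEq V] {G : SimpleGraph V} [G.LocallyFinite]

/-! ## §1 Measurability -/

section Measurability

variable [Countable V]

/-- The accepted label `x_n` is a measurable function of the label field. [cite: ChayesChayesNewman1985, §2 (x_n)] -/
theorem measurable_acceptedLabel (o : V) (n : ℕ) : Measurable fun U : Sym2 V → ℝ => acceptedLabel G U o n := by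
  refine measurable_of_Ioi fun y => ?_
  exact measurableSet_setOf.2 (measurable_lt_acceptedLabel (G := G) o y n)

/-- The event "`m` is an outlet step of the invasion from `o`" is measurable. [cite: LyonsPeresSchramm2006, Thm. 3.12 (proof)] -/
theorem measurableSet_isOutlet (o : V) (m : ℕ) : MeasurableSet {U : Sym2 V → ℝ | IsOutlet G U o m} := by
  simp only [isOutlet_iff]
  refine measurableSet_setOf.2 (Measurable.forall fun n => measurable_const.imp ?_)
  exact measurableSet_setOf.1 (measurableSet_lt (measurable_acceptedLabel o n) (measurable_acceptedLabel o m))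

/-- The event "dart `a` is absorbed at step `n`" is measurable. [cite: ChayesChayesNewman1985, §2 (the model)] -/
theorem measurable_newDart_invasion_eq (o : V) (n : ℕ) (v : Option (V × V)) :
    Measurable fun U : Sym2 V → ℝ => newDart G U (invasion G U o n) = v := by
  have : (fun U : Sym2 V → ℝ => newDart G U (invasion G U o n) = v) =
      fun U => ∃ I : Finset V, invasion G U o n = I ∧ newDart G U I = v := by
    ext U; exact ⟨fun h => ⟨_, rfl, h⟩, fun ⟨I, hI, h⟩ => hI ▸ h⟩
  rw [this]
  exact Measurable.exists fun I => (measurable_invasion_eq o n I).and (measurable_newDart_eq I v)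

/-- **The bond set of the invasion tree `T(o)` is a measurable function of the labels** (as a point of `Set (Sym2 V)` with the product σ-algebra).
[cite: LyonsPeresSchramm2006, §3 (invasion tree)] -/
theorem measurable_treeEdges (o : V) : Measurable fun U : Sym2 V → ℝ => treeEdges G U o := by
  refine measurable_set_iff.2 fun e => ?_
  have : (fun U : Sym2 V → ℝ => e ∈ treeEdges G U o) =
      fun U => ∃ n : ℕ, ∃ a : V × V, newDart G U (invasion G U o n) = some a ∧ s(a.1, a.2) = e := by
    ext U; simp only [mem_treeEdges]
  rw [this]
  exact Measurable.exists fun n => Measurable.exists fun a => (measurable_newDart_invasion_eq o n (some a)).and measurable_const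

/-- **The WMSF `𝔉_w(U)` is a measurable function of the labels.** [cite: LyonsPeresSchramm2006, §3 (p. 1671)] -/
theorem measurable_wmsf : Measurable fun U : Sym2 V → ℝ => wmsf G U := by
  refine measurable_set_iff.2 fun e => ?_
  have : (fun U : Sym2 V → ℝ => e ∈ wmsf G U) = fun U => ∃ W : Finset V, ∃ a : V × V, a ∈ boundaryDarts G W ∧ s(a.1, a.2) = e ∧
      ∀ b : V × V, b ∈ boundaryDarts G W → s(b.1, b.2) ≠ e → U e < U s(b.1, b.2) := by
    ext U
    exact mem_wmsf G
  rw [this]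
  refine Measurable.exists fun W => Measurable.exists fun a => measurable_const.and (measurable_const.and ?_)
  refine Measurable.forall fun b => measurable_const.imp (measurable_const.imp ?_)
  exact measurableSet_setOf.1 (measurableSet_lt (measurable_pi_apply _) (measurable_pi_apply _))

omit [DecidableEq V] [G.LocallyFinite] in
/-- Injectivity of the label field is a measurable event. [folklore] -/
theorem measurableSet_injective : MeasurableSet {U : Sym2 V → ℝ | Function.Injective U} := by
  have : {U : Sym2 V → ℝ | Function.Injective U} = {U | ∀ e e' : Sym2 V, U e = U e' → e = e'} := by
    ext U; exact Iff.rfl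
  rw [this]
  refine measurableSet_setOf.2 (Measurable.forall fun e => Measurable.forall fun e' => Measurable.imp ?_ measurable_const)
  exact measurableSet_setOf.1 (measurableSet_eq_fun (measurable_pi_apply e) (measurable_pi_apply e'))

/-- The event "`ξ(x, y; T_U(o))`: the branch of `y` at `x` in the invasion tree of `o` is infinite" is measurable. [cite: LyonsPeres2016, Prop. 8.18 (ξ)] -/
theorem measurableSet_infBranch_treeEdges (o x y : V) : MeasurableSet {U : Sym2 V → ℝ | InfBranch (treeEdges G U o) x y} :=
  (measurableSet_setOf_infBranch x y).preimage (measurable_treeEdges o)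

/-- The event "`ξ(x, y; 𝔉_w(U))`" is measurable. [cite: LyonsPeres2016, Prop. 8.18 (ξ)] -/
theorem measurableSet_infBranch_wmsf (x y : V) : MeasurableSet {U : Sym2 V → ℝ | InfBranch (wmsf G U) x y} :=
  (measurableSet_setOf_infBranch x y).preimage (measurable_wmsf (G := G))

/-- Forest connections `{u ⟷ v in 𝔉_w(U)}` are measurable events. [folklore] -/
theorem measurableSet_wmsf_reachable (u v : V) :
    MeasurableSet {U : Sym2 V → ℝ | (SimpleGraph.fromEdgeSet (wmsf G U)).Reachable u v} :=
  measurableSet_reachable_comp (measurable_wmsf (G := G)) u v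

/-- Constrained forest connections (`y` in the `K`-constrained `𝔉_w(U)`-cluster of `x`) are measurable events. [folklore] -/
theorem measurableSet_wmsf_openClusterIn (K : SimpleGraph V) (x y : V) :
    MeasurableSet {U : Sym2 V → ℝ | y ∈ openClusterIn K (wmsf G U) x} :=
  (measurableSet_openConnVia K x y).preimage (measurable_wmsf (G := G))

end Measurability

/-! ## §2 Equivariance under graph isomorphisms -/

section Iso

variable {W : Type*} [DecidableEq W] {G' : SimpleGraph W} [G'.LocallyFinite]

/-- **The invasion tree is transported by a graph isomorphism** (labels injective on the bonds, transported labels `U' s(φ u, φ v) = U s(u, v)`):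
`T_{U'}(φ o) = φ_* T_U(o)`. [cite: LyonsPeresSchramm2006, §3 (invasion tree)] -/
theorem treeEdges_iso (φ : G ≃g G') {U : Sym2 V → ℝ} {U' : Sym2 W → ℝ} (hUU' : ∀ u v, U' s(φ u, φ v) = U s(u, v))
    (hU : Set.InjOn U G.edgeSet) (o : V) : treeEdges G' U' (φ o) = Sym2.map φ '' treeEdges G U o := by
  ext e
  simp only [mem_treeEdges, Set.mem_image]
  constructor
  · rintro ⟨n, a', ha', rfl⟩
    rw [invasion_image_iso φ hUU' hU o n, newDart_image_iso φ hUU' hU] at ha'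
    cases hd : newDart G U (invasion G U o n) with
    | none => rw [hd] at ha'; exact absurd ha' (by simp)
    | some a =>
      rw [hd, Option.map_some] at ha'
      obtain rfl := Option.some_injective _ ha'
      exact ⟨s(a.1, a.2), ⟨n, a, hd, rfl⟩, by simp [Prod.map_fst, Prod.map_snd]⟩
  · rintro ⟨e₀, ⟨n, a, ha, rfl⟩, rfl⟩
    refine ⟨n, Prod.map φ φ a, ?_, by simp⟩
    rw [invasion_image_iso φ hUU' hU o n, newDart_image_iso φ hUU' hU, ha, Option.map_some]

/-- **The WMSF is transported by a graph isomorphism** (every label field): `𝔉_w(U') = φ_* 𝔉_w(U)`. [cite: LyonsPeresSchramm2006, §3 (p. 1671)] -/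
theorem wmsf_iso (φ : G ≃g G') {U : Sym2 V → ℝ} {U' : Sym2 W → ℝ} (hUU' : ∀ u v, U' s(φ u, φ v) = U s(u, v)) :
    wmsf G' U' = Sym2.map φ '' wmsf G U := by
  have hUU'e : ∀ e : Sym2 V, U' (Sym2.map φ e) = U e := by
    intro e; induction e using Sym2.ind with
    | h u v => rw [Sym2.map_mk]; exact hUU' u v
  ext e
  simp only [Set.mem_image]
  constructor
  · rintro ⟨W', a', ha', rfl, hmin⟩
    -- pull the cut back along `φ`
    set Wv : Finset V := W'.image φ.symm with hWv
    have hW' : W' = Wv.image φ := by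
      rw [hWv, Finset.image_image]
      have : (⇑φ ∘ ⇑φ.symm) = id := funext fun x => φ.apply_symm_apply x
      rw [this, Finset.image_id]
    rw [hW', boundaryDarts_image_iso] at ha' hmin
    obtain ⟨a, ha, rfl⟩ := Finset.mem_image.1 ha'
    refine ⟨s(a.1, a.2), (mem_wmsf G).2 ⟨Wv, a, ha, rfl, fun b hb hne => ?_⟩, by simp⟩
    have ha2 : s((Prod.map φ φ a).1, (Prod.map φ φ a).2) = Sym2.map φ s(a.1, a.2) := by simp
    have hb2 : s((Prod.map φ φ b).1, (Prod.map φ φ b).2) = Sym2.map φ s(b.1, b.2) := by simp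
    have h := hmin (Prod.map φ φ b) (Finset.mem_image_of_mem _ hb) (fun heq => hne ?_)
    · rwa [ha2, hb2, hUU'e, hUU'e] at h
    · rw [ha2, hb2] at heq
      exact Sym2.map.injective φ.injective heq
  · rintro ⟨e₀, he₀, rfl⟩
    obtain ⟨Wv, a, ha, rfl, hmin⟩ := (mem_wmsf G).1 he₀
    refine (mem_wmsf G').2 ⟨Wv.image φ, Prod.map φ φ a, ?_, by simp, fun b' hb' hne => ?_⟩
    · rw [boundaryDarts_image_iso]; exact Finset.mem_image_of_mem _ ha
    · rw [boundaryDarts_image_iso] at hb'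
      obtain ⟨b, hb, rfl⟩ := Finset.mem_image.1 hb'
      have hb2 : s((Prod.map φ φ b).1, (Prod.map φ φ b).2) = Sym2.map φ s(b.1, b.2) := by simp
      rw [hb2, hUU'e, hUU'e]
      refine hmin b hb fun heq => hne ?_
      rw [hb2, heq]

end Iso

/-! ### The diagonal action of an automorphism on vertices and labels -/

section Act

omit [DecidableEq V] [G.LocallyFinite] in
/-- The transported labels: `(actLabels γ U) s(γ u, γ v) = U s(u, v)`. [folklore] -/
theorem actLabels_mk (γ : G ≃g G) (U : Sym2 V → ℝ) (u v : V) : actLabels γ U s(γ u, γ v) = U s(u, v) := by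
  simp only [actLabels, Function.comp_apply, sym2Equiv_apply, Sym2.map_mk]
  show U s(γ.toEquiv.symm (γ u), γ.toEquiv.symm (γ v)) = U s(u, v)
  rw [show γ.toEquiv.symm (γ u) = u from γ.toEquiv.symm_apply_apply u, show γ.toEquiv.symm (γ v) = v from γ.toEquiv.symm_apply_apply v]

omit [DecidableEq V] [G.LocallyFinite] in
/-- Injectivity of the labels is invariant under the action. [folklore] -/
theorem injective_actLabels_iff (γ : G ≃g G) (U : Sym2 V → ℝ) : Function.Injective (actLabels γ U) ↔ Function.Injective U := by
  unfold actLabels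
  exact (Equiv.injective_comp (sym2Equiv γ.toEquiv.symm) U)

omit [DecidableEq V] [G.LocallyFinite] in
/-- `Sym2.map γ '' ω` is the relabelled configuration `relabel (sym2Equiv γ) ω`. [folklore] -/
theorem image_sym2Map_eq_relabel (γ : G ≃g G) (ω : BondConfig V) :
    Sym2.map γ '' ω = BondConfig.relabel (sym2Equiv γ.toEquiv) ω := by
  rw [BondConfig.relabel_apply]
  ext e
  simp only [Set.mem_image, sym2Equiv_apply]
  rfl

/-- **The invasion trees are equivariant**: `T_{γ·U}(γ o) = γ_* T_U(o)` for injective labels. [cite: LyonsPeresSchramm2006, §3 (invasion tree)] -/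
theorem treeEdges_actLabels (γ : G ≃g G) {U : Sym2 V → ℝ} (hU : Function.Injective U) (o : V) :
    treeEdges G (actLabels γ U) (γ o) = BondConfig.relabel (sym2Equiv γ.toEquiv) (treeEdges G U o) := by
  rw [← image_sym2Map_eq_relabel]
  exact treeEdges_iso γ (actLabels_mk γ U) hU.injOn o

/-- **The WMSF is equivariant**: `𝔉_w(γ·U) = γ_* 𝔉_w(U)`. [cite: LyonsPeresSchramm2006, §3 (p. 1671)] -/
theorem wmsf_actLabels (γ : G ≃g G) (U : Sym2 V → ℝ) :
    wmsf G (actLabels γ U) = BondConfig.relabel (sym2Equiv γ.toEquiv) (wmsf G U) := by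
  rw [← image_sym2Map_eq_relabel]
  exact wmsf_iso γ (actLabels_mk γ U)

/-- Infinite branches of the invasion trees are equivariant (injective labels). [cite: LyonsPeres2016, Prop. 8.18 (ξ is diagonally invariant)] -/
theorem infBranch_treeEdges_actLabels_iff (γ : G ≃g G) {U : Sym2 V → ℝ} (hU : Function.Injective U) (o x y : V) :
    InfBranch (treeEdges G (actLabels γ U) (γ o)) (γ x) (γ y) ↔ InfBranch (treeEdges G U o) x y := by
  rw [treeEdges_actLabels γ hU o]
  exact infBranch_relabel_iff γ.toEquiv (treeEdges G U o) x y

/-- Infinite branches of the WMSF are equivariant. [cite: LyonsPeres2016, Prop. 8.18 (ξ is diagonally invariant)] -/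
theorem infBranch_wmsf_actLabels_iff (γ : G ≃g G) (U : Sym2 V → ℝ) (x y : V) :
    InfBranch (wmsf G (actLabels γ U)) (γ x) (γ y) ↔ InfBranch (wmsf G U) x y := by
  rw [wmsf_actLabels γ U]
  exact infBranch_relabel_iff γ.toEquiv (wmsf G U) x y

/-- Forest connections are equivariant. [folklore] -/
theorem wmsf_reachable_actLabels_iff (γ : G ≃g G) (U : Sym2 V → ℝ) (u v : V) :
    (SimpleGraph.fromEdgeSet (wmsf G (actLabels γ U))).Reachable (γ u) (γ v) ↔ (SimpleGraph.fromEdgeSet (wmsf G U)).Reachable u v := by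
  rw [wmsf_actLabels γ U]
  exact reachable_relabel_iff γ.toEquiv (wmsf G U) u v

/-- Constrained forest clusters avoiding a vertex are equivariant. [folklore] -/
theorem mem_openClusterIn_wmsf_actLabels_iff (γ : G ≃g G) (U : Sym2 V → ℝ) (z x y : V) :
    γ y ∈ openClusterIn (withinGraph ⊤ ({γ z} : Set V)ᶜ) (wmsf G (actLabels γ U)) (γ x) ↔
      y ∈ openClusterIn (withinGraph ⊤ ({z} : Set V)ᶜ) (wmsf G U) x := by
  rw [wmsf_actLabels γ U]
  show γ.toEquiv y ∈ openClusterIn (withinGraph ⊤ ({γ.toEquiv z} : Set V)ᶜ) (BondConfig.relabel (sym2Equiv γ.toEquiv) (wmsf G U))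
    (γ.toEquiv x) ↔ _
  rw [openClusterIn_relabel γ.toEquiv (withinGraph_top_compl_singleton_adj_iff γ.toEquiv z) (wmsf G U) x]
  constructor
  · rintro ⟨y', hy', h⟩
    rwa [← γ.injective h]
  · exact fun h => ⟨y, h, rfl⟩

end Act

end General

end Summit.CriticalPhenomena.PercolationContinuityZ3.Theorems.Rsw3
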